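import Summits.RiemannHypothesis.RiemannHypothesis.Theses.WeilComb
import Summits.RiemannHypothesis.RiemannHypothesis.Theorems.WeilCombCombShapePositivityStubSymbolExpSum
import Summits.RiemannHypothesis.RiemannHypothesis.Theorems.WeilCombCombShapeDetection
import Literature.NumberTheory.LFunctions.WeilCriterionConverse
import Mathlib

/-!
# Stub `stub_fejerZeroProduct` (plan T4, zero-side product formula) for crux `WeilComb.CombShapePositivity`
(item stmt-RiemannHypothesis-11229, route route-RiemannHypothesis-WeilComb, line `Sketch`,
stub-plan `Cruxes/CombShapePositivity/STUB-PLAN-stub_fejer.md`, tier T4 "zero-side product formula")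

Notation: `φ_ε(t) = ε⁻¹ expNegInvGlue (1 − (t/ε)²)` (the route bump), comb symbol
`w_ε(x) = W(τ_x (φ_ε ⋆ φ̃_ε))`, prime box `N = ∏_{p∈S} p^n`, Bohr character
`χ_θ(d) = exp(i Σ_{p∈S} θ_p v_p(d))`, `m(ρ)` the multiplicity of the non-trivial zero `ρ`,
`P_g(ρ) = ĝ(ρ) conj ĝ(1 − ρ̄)` (`WeilConverse.pairCoeff`).

**Statement (T4).** For `ε > 0`, every finite set of primes `S`, every `n` and `θ`,

  `Σ_{d, d' ∣ N} χ_θ(d) conj χ_θ(d') w_ε(log d − log d')`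
  `= Σ'_ρ m(ρ) P_{φ_ε}(ρ) ∏_{p∈S} (Σ_{j ≤ n} u_p^j)(Σ_{k ≤ n} u_p^{−k})`,
  `u_p = exp(iθ_p + (ρ − ½) log p)`:

the explicit formula for the "Fejér face" of the registered stub `stub_fejer`, in Bohr coordinates.

**Proof.** By T1 (`WeilCombBohrFejer.stub_symbolExpSum`, the explicit formula for the test
`τ_x(φ_ε ⋆ φ̃_ε)`, `Theorems/WeilCombCombShapePositivityStubSymbolExpSum.lean`) the symbol is the absolutely convergent exponential series
`w_ε(x) = B_{φ_ε}(x) = Σ_ρ m(ρ) P_{φ_ε}(ρ) e^{(ρ−½)x}` (`WeilConverse.expSum`,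
`WeilConverse.summable_expSum`), so the finite double sum commutes with the zero sum (`hasSum_sum`).
For a fixed zero put `w = ρ − ½`. A divisor `d ∣ N` is `∏_{p∈S} p^{v_p(d)}`
(`Nat.prod_factorization_pow_eq_self`), so `log d = Σ_p v_p(d) log p` and
`χ_θ(d) e^{w log d} = ∏_p u_p^{v_p(d)}`, `conj χ_θ(d') e^{−w log d'} = ∏_p (u_p⁻¹)^{v_p(d')}`
(`|χ_θ| = 1`). Finally `Σ_{d ∣ N} ∏_{p∈S} u_p^{v_p(d)} = ∏_{p∈S} Σ_{j ≤ n} u_p^j`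
(`sum_divisors_primeBox_prod_pow`, by induction on `S`: the divisors of `q^n · N_S` are the
products `q^i b`, `b ∣ N_S`, `Nat.Coprime.divisors_mul`), and the two divisor sums multiply to
`∏_p (Σ_j u_p^j)(Σ_k u_p^{−k})` (`Finset.prod_mul_distrib`).

All statements are unconditional bookkeeping plus the in-tree explicit formula; no sign
information (the sign of the face is the crux, equivalent to RH).
-/

noncomputable section

-- the sub-problem path RiemannHypothesis/RiemannHypothesis duplicates a namespace (D-0017)
set_option linter.dupNamespace false

open scoped BigOperators ComplexConjugate
open Complex

namespace Summit.RiemannHypothesis.RiemannHypothesis.Theorems.WeilCombBohrFejer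

open Literature.NumberTheory.LFunctions
open Literature.NumberTheory.LFunctions.WeilConverse
/-! ## Divisors of the prime box `N = ∏_{p∈S} p^n` -/

/-- A divisor of the prime box `∏_{p∈S} p^n` has no prime factor outside `S`:
`v_q(d) = 0` for `q ∉ S`. [folklore] -/
theorem factorization_eq_zero_of_mem_divisors_primeBox {S : Finset ℕ} (hS : ∀ p ∈ S, p.Prime)
    (n : ℕ) {d q : ℕ} (hd : d ∈ (∏ p ∈ S, p ^ n).divisors) (hq : q ∉ S) :
    d.factorization q = 0 := by
  by_cases hqp : q.Prime
  · refine Nat.factorization_eq_zero_of_not_dvd fun hqd => hq ?_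
    obtain ⟨p, hp, hqpn⟩ :=
      (Prime.dvd_finsetProd_iff hqp.prime _).1 (hqd.trans (Nat.dvd_of_mem_divisors hd))
    rwa [(Nat.prime_dvd_prime_iff_eq hqp (hS p hp)).1 (hqp.dvd_of_dvd_pow hqpn)]
  · exact Nat.factorization_eq_zero_of_not_prime d hqp

/-- For `d ∣ N = ∏_{p∈S} p^n` the prime support of `d` lies in `S`. [folklore] -/
theorem factorization_support_subset_of_mem_divisors_primeBox {S : Finset ℕ}
    (hS : ∀ p ∈ S, p.Prime) (n : ℕ) {d : ℕ} (hd : d ∈ (∏ p ∈ S, p ^ n).divisors) :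
    d.factorization.support ⊆ S := by
  intro p hp
  by_contra hpS
  exact Finsupp.mem_support_iff.1 hp (factorization_eq_zero_of_mem_divisors_primeBox hS n hd hpS)

/-! ## Divisor sums of local products over the prime box -/

/-- **Divisor sums of local products over the prime box factorize.** For a finite set of primes
`S` and any `u : ℕ → ℂ`: `Σ_{d ∣ ∏_{p∈S} p^n} ∏_{p∈S} u_p^{v_p(d)} = ∏_{p∈S} Σ_{j ≤ n} u_p^j`
(induction on `S`; the divisors of `q^n · N_S` are the `q^i b`, `i ≤ n`, `b ∣ N_S`, uniquely:
`Nat.divisors_mul`, `Nat.Coprime.mul_injOn_divisors`). [folklore] -/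
theorem sum_divisors_primeBox_prod_pow {S : Finset ℕ} (hS : ∀ p ∈ S, p.Prime) (n : ℕ)
    (u : ℕ → ℂ) :
    ∑ d ∈ (∏ p ∈ S, p ^ n).divisors, ∏ p ∈ S, u p ^ d.factorization p =
      ∏ p ∈ S, ∑ j ∈ Finset.range (n + 1), u p ^ j := by
  classical
  induction S using Finset.induction_on with
  | empty => simp
  | @insert q S hqS ih =>
    have hq : q.Prime := hS q (Finset.mem_insert_self q S)
    have hS' : ∀ p ∈ S, p.Prime := fun p hp => hS p (Finset.mem_insert_of_mem hp)
    have hcop : (q ^ n).Coprime (∏ p ∈ S, p ^ n) :=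
      Nat.Coprime.prod_right fun p hp =>
        Nat.coprime_pow_primes n n hq (hS' p hp) fun h : q = p => hqS (h ▸ hp)
    have hN : ∏ p ∈ insert q S, p ^ n = q ^ n * ∏ p ∈ S, p ^ n := Finset.prod_insert hqS
    have hR : ∏ p ∈ insert q S, ∑ j ∈ Finset.range (n + 1), u p ^ j =
        (∑ j ∈ Finset.range (n + 1), u q ^ j) * ∏ p ∈ S, ∑ j ∈ Finset.range (n + 1), u p ^ j :=
      Finset.prod_insert hqS
    -- the divisors of the coprime product `q^n · N_S` are the products `a b`, `a ∣ q^n`, `b ∣ N_S`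
    rw [hN, hR, Nat.divisors_mul, ← Finset.image_mul_product,
      Finset.sum_image hcop.mul_injOn_divisors, Finset.sum_product, Nat.sum_divisors_prime_pow hq,
      ← ih hS', Finset.sum_mul_sum]
    refine Finset.sum_congr rfl fun i _ => Finset.sum_congr rfl fun b hb => ?_
    have hb0 : b ≠ 0 := (Nat.pos_of_mem_divisors hb).ne'
    have hbq : b.factorization q = 0 := factorization_eq_zero_of_mem_divisors_primeBox hS' n hb hqS
    rw [Finset.prod_insert hqS, Nat.factorization_mul (pow_ne_zero i hq.ne_zero) hb0,
      Finsupp.add_apply, hq.factorization_pow, Finsupp.single_eq_same, hbq, add_zero]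
    congr 1
    refine Finset.prod_congr rfl fun p hp => ?_
    rw [Finsupp.add_apply, Finsupp.single_eq_of_ne (fun h : p = q => hqS (h ▸ hp)), zero_add]

/-! ## The Bohr nodes `χ_θ(d) d^w` factor over the primes of the box -/

/-- For `d ∣ N = ∏_{p∈S} p^n`: `log d = Σ_{p∈S} v_p(d) log p` (`d = ∏_{p∈S} p^{v_p(d)}`,
`Nat.prod_factorization_pow_eq_self`). [folklore] -/
theorem log_eq_sum_factorization_of_mem_divisors_primeBox {S : Finset ℕ}
    (hS : ∀ p ∈ S, p.Prime) (n : ℕ) {d : ℕ} (hd : d ∈ (∏ p ∈ S, p ^ n).divisors) :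
    Real.log (d : ℝ) = ∑ p ∈ S, (d.factorization p : ℝ) * Real.log (p : ℝ) := by
  have hd0 : d ≠ 0 := (Nat.pos_of_mem_divisors hd).ne'
  have hprod : (d : ℝ) = ∏ p ∈ S, (p : ℝ) ^ d.factorization p := by
    have h := Nat.prod_factorization_pow_eq_self hd0
    rw [Finsupp.prod_of_support_subset _
      (factorization_support_subset_of_mem_divisors_primeBox hS n hd) _ fun p _ => pow_zero p] at h
    exact_mod_cast h.symm
  rw [hprod, Real.log_prod fun p hp => pow_ne_zero _ (Nat.cast_ne_zero.2 (hS p hp).ne_zero)]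
  exact Finset.sum_congr rfl fun p _ => Real.log_pow _ _

/-- **Bohr node factorization.** For `d ∣ N`: `χ_θ(d) e^{w log d} = ∏_{p∈S} u_p^{v_p(d)}` with
`u_p = exp(iθ_p + w log p)`. [folklore] -/
theorem bohrChar_mul_cexp_log {S : Finset ℕ} (hS : ∀ p ∈ S, p.Prime) (n : ℕ) (θ : ℕ → ℝ)
    (w : ℂ) {d : ℕ} (hd : d ∈ (∏ p ∈ S, p ^ n).divisors) :
    Complex.exp (I * ((∑ p ∈ S, θ p * (d.factorization p : ℝ) : ℝ) : ℂ)) *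
        Complex.exp (w * (Real.log (d : ℝ) : ℂ)) =
      ∏ p ∈ S, Complex.exp (I * (θ p : ℂ) + w * (Real.log (p : ℝ) : ℂ)) ^ d.factorization p := by
  rw [log_eq_sum_factorization_of_mem_divisors_primeBox hS n hd, ← Complex.exp_add]
  simp only [Complex.ofReal_sum, Complex.ofReal_mul, Complex.ofReal_natCast]
  rw [Finset.mul_sum, Finset.mul_sum, ← Finset.sum_add_distrib, Complex.exp_sum]
  refine Finset.prod_congr rfl fun p _ => ?_
  rw [← Complex.exp_nat_mul]
  congr 1
  ring

/-- **Conjugate Bohr node.** For `d ∣ N`: `conj χ_θ(d) e^{−w log d} = ∏_{p∈S} (u_p⁻¹)^{v_p(d)}`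
(`conj exp(ir) = exp(−ir)` for real `r`). [folklore] -/
theorem conj_bohrChar_mul_cexp_neg_log {S : Finset ℕ} (hS : ∀ p ∈ S, p.Prime) (n : ℕ) (θ : ℕ → ℝ)
    (w : ℂ) {d : ℕ} (hd : d ∈ (∏ p ∈ S, p ^ n).divisors) :
    conj (Complex.exp (I * ((∑ p ∈ S, θ p * (d.factorization p : ℝ) : ℝ) : ℂ))) *
        Complex.exp (-(w * (Real.log (d : ℝ) : ℂ))) =
      ∏ p ∈ S, (Complex.exp (I * (θ p : ℂ) + w * (Real.log (p : ℝ) : ℂ)))⁻¹ ^ d.factorization p := by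
  rw [← Complex.exp_conj, map_mul, Complex.conj_I, Complex.conj_ofReal, neg_mul, Complex.exp_neg,
    Complex.exp_neg, ← mul_inv, bohrChar_mul_cexp_log hS n θ w hd, ← Finset.prod_inv_distrib]
  exact Finset.prod_congr rfl fun p _ => (inv_pow _ _).symm

/-! ## The box form of one exponential, and of the exponential series -/

/-- **The box form of one exponential mode.** For `w c : ℂ`:
`Σ_{d,d' ∣ N} χ_θ(d) conj χ_θ(d') · c e^{w (log d − log d')} = c ∏_{p∈S} (Σ_{j≤n} u_p^j)(Σ_{k≤n} (u_p⁻¹)^k)`,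
`u_p = exp(iθ_p + w log p)` (node factorization, then `sum_divisors_primeBox_prod_pow` twice). [folklore] -/
theorem boxForm_cexp {S : Finset ℕ} (hS : ∀ p ∈ S, p.Prime) (n : ℕ) (θ : ℕ → ℝ) (w c : ℂ) :
    ∑ d ∈ (∏ p ∈ S, p ^ n).divisors, ∑ d' ∈ (∏ p ∈ S, p ^ n).divisors,
      Complex.exp (I * ((∑ p ∈ S, θ p * (d.factorization p : ℝ) : ℝ) : ℂ)) *
        conj (Complex.exp (I * ((∑ p ∈ S, θ p * (d'.factorization p : ℝ) : ℝ) : ℂ))) *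
        (c * Complex.exp (w * ((Real.log (d : ℝ) - Real.log (d' : ℝ) : ℝ) : ℂ))) =
    c * ∏ p ∈ S, ((∑ j ∈ Finset.range (n + 1),
        Complex.exp (I * (θ p : ℂ) + w * (Real.log (p : ℝ) : ℂ)) ^ j) *
      (∑ k ∈ Finset.range (n + 1),
        (Complex.exp (I * (θ p : ℂ) + w * (Real.log (p : ℝ) : ℂ)))⁻¹ ^ k)) := by
  calc _ = ∑ d ∈ (∏ p ∈ S, p ^ n).divisors, ∑ d' ∈ (∏ p ∈ S, p ^ n).divisors, c *
        ((Complex.exp (I * ((∑ p ∈ S, θ p * (d.factorization p : ℝ) : ℝ) : ℂ)) *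
            Complex.exp (w * (Real.log (d : ℝ) : ℂ))) *
          (conj (Complex.exp (I * ((∑ p ∈ S, θ p * (d'.factorization p : ℝ) : ℝ) : ℂ))) *
            Complex.exp (-(w * (Real.log (d' : ℝ) : ℂ))))) := by
        refine Finset.sum_congr rfl fun d _ => Finset.sum_congr rfl fun d' _ => ?_
        rw [Complex.ofReal_sub, mul_sub, sub_eq_add_neg, Complex.exp_add]
        ring
    _ = c * ((∑ d ∈ (∏ p ∈ S, p ^ n).divisors,
          ∏ p ∈ S, Complex.exp (I * (θ p : ℂ) + w * (Real.log (p : ℝ) : ℂ)) ^ d.factorization p) *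
        (∑ d' ∈ (∏ p ∈ S, p ^ n).divisors,
          ∏ p ∈ S, (Complex.exp (I * (θ p : ℂ) + w * (Real.log (p : ℝ) : ℂ)))⁻¹ ^
            d'.factorization p)) := by
        rw [Finset.sum_mul_sum, Finset.mul_sum]
        refine Finset.sum_congr rfl fun d hd => ?_
        rw [Finset.mul_sum]
        refine Finset.sum_congr rfl fun d' hd' => ?_
        rw [bohrChar_mul_cexp_log hS n θ w hd, conj_bohrChar_mul_cexp_neg_log hS n θ w hd']
    _ = _ := by
        rw [sum_divisors_primeBox_prod_pow hS n
            (fun p => Complex.exp (I * (θ p : ℂ) + w * (Real.log (p : ℝ) : ℂ))),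
          sum_divisors_primeBox_prod_pow hS n
            (fun p => (Complex.exp (I * (θ p : ℂ) + w * (Real.log (p : ℝ) : ℂ)))⁻¹),
          ← Finset.prod_mul_distrib]

/-- **Zero-side product formula for the exponential series of a Weil test.** For a Weil test `g`,
a finite set of primes `S`, `n` and `θ`:
`Σ_{d,d' ∣ N} χ_θ(d) conj χ_θ(d') B_g(log d − log d') = Σ'_ρ m(ρ) P_g(ρ) ∏_{p∈S} (Σ_{j≤n} u_p^j)(Σ_{k≤n} (u_p⁻¹)^k)`,
`u_p = exp(iθ_p + (ρ − ½) log p)` (the zero sum is absolutely convergent, `summable_expSum`, so it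
commutes with the finite box sum; then `boxForm_cexp` termwise). [folklore] -/
theorem boxForm_expSum {g : ℝ → ℂ} (hg : IsWeilTest g) {S : Finset ℕ} (hS : ∀ p ∈ S, p.Prime)
    (n : ℕ) (θ : ℕ → ℝ) :
    ∑ d ∈ (∏ p ∈ S, p ^ n).divisors, ∑ d' ∈ (∏ p ∈ S, p ^ n).divisors,
      Complex.exp (I * ((∑ p ∈ S, θ p * (d.factorization p : ℝ) : ℝ) : ℂ)) *
        conj (Complex.exp (I * ((∑ p ∈ S, θ p * (d'.factorization p : ℝ) : ℝ) : ℂ))) *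
        expSum g (Real.log (d : ℝ) - Real.log (d' : ℝ)) =
    ∑' ρ : ZetaZeros.riemannZetaNontrivialZeros, (riemannZetaZeroOrder (ρ : ℂ) : ℂ) *
      pairCoeff g (ρ : ℂ) *
      ∏ p ∈ S, ((∑ j ∈ Finset.range (n + 1),
          Complex.exp (I * (θ p : ℂ) + ((ρ : ℂ) - 1 / 2) * (Real.log (p : ℝ) : ℂ)) ^ j) *
        (∑ k ∈ Finset.range (n + 1),
          (Complex.exp (I * (θ p : ℂ) + ((ρ : ℂ) - 1 / 2) * (Real.log (p : ℝ) : ℂ)))⁻¹ ^ k)) := by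
  have h : HasSum (fun ρ : ZetaZeros.riemannZetaNontrivialZeros =>
      ∑ d ∈ (∏ p ∈ S, p ^ n).divisors, ∑ d' ∈ (∏ p ∈ S, p ^ n).divisors,
        Complex.exp (I * ((∑ p ∈ S, θ p * (d.factorization p : ℝ) : ℝ) : ℂ)) *
          conj (Complex.exp (I * ((∑ p ∈ S, θ p * (d'.factorization p : ℝ) : ℝ) : ℂ))) *
          ((riemannZetaZeroOrder (ρ : ℂ) : ℂ) * pairCoeff g (ρ : ℂ) *
            Complex.exp (((ρ : ℂ) - 1 / 2) * ((Real.log (d : ℝ) - Real.log (d' : ℝ) : ℝ) : ℂ))))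
      (∑ d ∈ (∏ p ∈ S, p ^ n).divisors, ∑ d' ∈ (∏ p ∈ S, p ^ n).divisors,
        Complex.exp (I * ((∑ p ∈ S, θ p * (d.factorization p : ℝ) : ℝ) : ℂ)) *
          conj (Complex.exp (I * ((∑ p ∈ S, θ p * (d'.factorization p : ℝ) : ℝ) : ℂ))) *
          expSum g (Real.log (d : ℝ) - Real.log (d' : ℝ))) :=
    hasSum_sum fun d _ => hasSum_sum fun d' _ => (summable_expSum hg _).hasSum.mul_left _
  rw [← h.tsum_eq]
  exact tsum_congr fun ρ =>
    boxForm_cexp hS n θ ((ρ : ℂ) - 1 / 2) ((riemannZetaZeroOrder (ρ : ℂ) : ℂ) * pairCoeff g (ρ : ℂ))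

/-! ## The registered stub -/

/-- **T4 `stub_fejerZeroProduct`** (registered stub of crux stmt-RiemannHypothesis-11229, plan
STUB-PLAN-stub_fejer, tier T4 "zero-side product formula"). For `ε > 0`, a finite set of primes `S`,
`n` and `θ`, the Fejér face of `stub_fejer` is the zero sum
`Σ'_ρ m(ρ) P_{φ_ε}(ρ) ∏_{p∈S} (Σ_{j≤n} u_p^j)(Σ_{k≤n} (u_p⁻¹)^k)`, `u_p = exp(iθ_p + (ρ − ½) log p)`:
the symbol identity T1 (`stub_symbolExpSum`) followed by `boxForm_expSum` for the Weil test `φ_ε`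
(`combShapeDetection_shapeBump_isWeilTest`). [folklore] -/
theorem stub_fejerZeroProduct : ∀ ε : ℝ, 0 < ε → ∀ S : Finset ℕ, (∀ p ∈ S, p.Prime) →
    ∀ (n : ℕ) (θ : ℕ → ℝ),
    (∑ d ∈ (∏ p ∈ S, p ^ n).divisors, ∑ d' ∈ (∏ p ∈ S, p ^ n).divisors,
      Complex.exp (I * ((∑ p ∈ S, θ p * (d.factorization p : ℝ) : ℝ) : ℂ)) *
        conj (Complex.exp (I * ((∑ p ∈ S, θ p * (d'.factorization p : ℝ) : ℝ) : ℂ))) *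
        weilFunctional (weilTranslate
          (weilConv (fun t : ℝ => (ε : ℂ)⁻¹ * ((expNegInvGlue (1 - (t / ε) ^ 2) : ℝ) : ℂ))
            (weilReflect (fun t : ℝ => (ε : ℂ)⁻¹ * ((expNegInvGlue (1 - (t / ε) ^ 2) : ℝ) : ℂ))))
          (Real.log (d : ℝ) - Real.log (d' : ℝ)))) =
    ∑' ρ : ZetaZeros.riemannZetaNontrivialZeros, (riemannZetaZeroOrder (ρ : ℂ) : ℂ) *
      Literature.NumberTheory.LFunctions.WeilConverse.pairCoeff
        (fun t : ℝ => (ε : ℂ)⁻¹ * ((expNegInvGlue (1 - (t / ε) ^ 2) : ℝ) : ℂ)) (ρ : ℂ) *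
      ∏ p ∈ S, ((∑ j ∈ Finset.range (n + 1),
          Complex.exp (I * (θ p : ℂ) + ((ρ : ℂ) - 1 / 2) * (Real.log (p : ℝ) : ℂ)) ^ j) *
        (∑ k ∈ Finset.range (n + 1),
          (Complex.exp (I * (θ p : ℂ) + ((ρ : ℂ) - 1 / 2) * (Real.log (p : ℝ) : ℂ)))⁻¹ ^ k)) := by
  intro ε hε S hS n θ
  refine Eq.trans ?_ (boxForm_expSum (combShapeDetection_shapeBump_isWeilTest ε) hS n θ)
  refine Finset.sum_congr rfl fun d _ => Finset.sum_congr rfl fun d' _ => ?_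
  rw [stub_symbolExpSum ε hε]

end Summit.RiemannHypothesis.RiemannHypothesis.Theorems.WeilCombBohrFejer

end
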